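import Literature.Computability.QuantumComplexity.GroverSearch

/-!
# Grover search with a KNOWN number of solutions: `⌊π/(4θ)⌋` iterations fail with probability `≤ t/N` (Boyer–Brassard–Høyer–Tapp 1998, §3)

Companion to `GroverSearch.lean` (which treats the unknown-`t` algorithm and proves BBHT's closed
formula `grover_iterate` / the branch acceptance probability `wt_groverBranch`).  Here: the case
"when the number of solutions is known" of BBHT §3 (arXiv:quant-ph/9605034, p. 4), quoted:

> "The probability of obtaining a solution is maximized when `ℓ_m` is as close to `0` as possible.
> We would have `ℓ_m̃ = 0` when `m̃ = (π − 2θ)/4θ` if that were an integer. Let `m = ⌊π/4θ⌋`.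
> Note that `|m − m̃| ≤ 1/2`. It follows that `|(2m+1)θ − (2m̃+1)θ| ≤ θ`. But `(2m̃+1)θ = π/2` by
> definition of `m̃`. Therefore `|cos((2m+1)θ)| ≤ |sin θ|`. We conclude that the probability of
> failure after exactly `m` iterations is `(N−t)ℓ_m² = cos²((2m+1)θ) ≤ sin²θ = t/N`."
> "Note that this algorithm runs in a time in `O(√(N/t))` since `θ ≥ sin θ = √(t/N)` and therefore
> `m ≤ π/(4θ) ≤ (π/4)√(N/t)`."

Main statements (all fact-free; `θ = thetaOf x`, `sin² θ = t/N` with `t = hw x` marked items):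

* `bbhtIter θ = ⌊π/(4θ)⌋` and `abs_bbhtIter_mul_sub_le` : `|(2m+1)θ − π/2| ≤ θ`;
* `cos_sq_bbhtIter_le` : `cos²((2m+1)θ) ≤ sin²θ` for `0 < θ ≤ π/2`
  (the printed step uses `|m − m̃| ≤ 1/2`; we use the equivalent floor inequalities
  `4mθ ≤ π < 4(m+1)θ` directly);
* `one_sub_le_sin_sq_bbhtIter_thetaOf` : `1 − t/N ≤ sin²((2m+1)θ)` — with `wt_groverBranch` this is
  the acceptance probability of the branch that performs `m` iterations
  (`wt_groverBranch_bbhtIter_ge`);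
* `bbhtIter_thetaOf_le` : `m ≤ π/(4θ) ≤ π/(4√(t/N)) = (π/4)·√(N/t)`.

Consumers (cell pub-qadeq): the "Grover baseline" lemmas of DEQ-A172 §2 and DEQ-A182 §2
(`r = ⌊π/(4θ_G)⌋` iterations succeed with probability `≥ 1 − M/N`).

## References
* M. Boyer, G. Brassard, P. Høyer, A. Tapp, *Tight bounds on quantum searching*, Fortschr. Phys. 46
  (1998) 493–505, §3 "the case t known" (arXiv:quant-ph/9605034 p. 4, read via
  `lit read arxiv:quant-ph/9605034`, chunk p0004 L41–62) [BoyerEtAl1998].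
-/

noncomputable section

namespace Literature.Computability.QuantumComplexity

open Real Finset QProg

namespace Grover

/-- BBHT's iteration count when `t` is known: `m = ⌊π/(4θ)⌋` (`sin² θ = t/N`).
[cite: BoyerEtAl1998, §3] -/
def bbhtIter (θ : ℝ) : ℕ := ⌊π / (4 * θ)⌋₊

/-- "`m ≤ π/4θ`". [cite: BoyerEtAl1998, §3] -/
theorem bbhtIter_le {θ : ℝ} (hθ : 0 < θ) : (bbhtIter θ : ℝ) ≤ π / (4 * θ) :=
  Nat.floor_le (by positivity)

/-- Floor property `π/(4θ) < m + 1`. [folklore] -/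
private theorem lt_bbhtIter_add_one (θ : ℝ) : π / (4 * θ) < bbhtIter θ + 1 :=
  Nat.lt_floor_add_one _

/-- "`|(2m+1)θ − (2m̃+1)θ| ≤ θ` … `(2m̃+1)θ = π/2`": the angle after `m = ⌊π/(4θ)⌋` iterations is
within `θ` of `π/2`. [cite: BoyerEtAl1998, §3] -/
theorem abs_bbhtIter_mul_sub_le {θ : ℝ} (hθ : 0 < θ) :
    |(2 * (bbhtIter θ : ℝ) + 1) * θ - π / 2| ≤ θ := by
  have h4 : (0 : ℝ) < 4 * θ := by positivity
  have h1 : (bbhtIter θ : ℝ) * (4 * θ) ≤ π := (le_div_iff₀ h4).1 (bbhtIter_le hθ)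
  have h2 : π < ((bbhtIter θ : ℝ) + 1) * (4 * θ) := (div_lt_iff₀ h4).1 (lt_bbhtIter_add_one θ)
  rw [abs_le]
  constructor <;> nlinarith

/-- If `|v| ≤ θ ≤ π/2` then `sin² v ≤ sin² θ` (monotonicity of `cos` on `[0, π]`). [folklore] -/
private theorem sin_sq_le_sin_sq_of_abs_le {v θ : ℝ} (hv : |v| ≤ θ) (hθ : θ ≤ π / 2) :
    Real.sin v ^ 2 ≤ Real.sin θ ^ 2 := by
  have hθ0 : 0 ≤ θ := (abs_nonneg v).trans hv
  have hcosθ : 0 ≤ Real.cos θ := Real.cos_nonneg_of_mem_Icc ⟨by linarith, hθ⟩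
  have hcos : Real.cos θ ≤ Real.cos v := by
    rw [← Real.cos_abs v]
    exact Real.cos_le_cos_of_nonneg_of_le_pi (abs_nonneg v) (by linarith [Real.pi_pos]) hv
  have hsq : Real.cos θ ^ 2 ≤ Real.cos v ^ 2 := pow_le_pow_left₀ hcosθ hcos 2
  nlinarith [Real.sin_sq_add_cos_sq v, Real.sin_sq_add_cos_sq θ]

/-- **BBHT 1998 §3, known `t`**: "`|cos((2m+1)θ)| ≤ |sin θ|`", squared: after `m = ⌊π/(4θ)⌋`
iterations `cos²((2m+1)θ) ≤ sin² θ` (`0 < θ ≤ π/2`). [cite: BoyerEtAl1998, §3] -/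
theorem cos_sq_bbhtIter_le {θ : ℝ} (hθ : 0 < θ) (hθ2 : θ ≤ π / 2) :
    Real.cos ((2 * (bbhtIter θ : ℝ) + 1) * θ) ^ 2 ≤ Real.sin θ ^ 2 := by
  have e : (2 * (bbhtIter θ : ℝ) + 1) * θ = ((2 * (bbhtIter θ : ℝ) + 1) * θ - π / 2) + π / 2 := by
    ring
  rw [e, Real.cos_add_pi_div_two, neg_sq]
  exact sin_sq_le_sin_sq_of_abs_le (abs_bbhtIter_mul_sub_le hθ) hθ2

/-- "the probability of failure after exactly `m` iterations is `cos²((2m+1)θ) ≤ sin²θ`", as a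
success bound: `1 − sin² θ ≤ sin²((2m+1)θ)`. [cite: BoyerEtAl1998, §3] -/
theorem one_sub_sin_sq_le_sin_sq_bbhtIter {θ : ℝ} (hθ : 0 < θ) (hθ2 : θ ≤ π / 2) :
    1 - Real.sin θ ^ 2 ≤ Real.sin ((2 * (bbhtIter θ : ℝ) + 1) * θ) ^ 2 := by
  have h := cos_sq_bbhtIter_le hθ hθ2
  nlinarith [Real.sin_sq_add_cos_sq ((2 * (bbhtIter θ : ℝ) + 1) * θ)]

/-! ### In the vocabulary of `GroverSearch.lean`: `θ = thetaOf x`, `sin² θ = t/N`, `t = hw x` -/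

section Marked

variable {N : ℕ}

/-- "the angle `θ` is defined so that `sin² θ = t/N` and `0 < θ ≤ π/2`": positivity when `t ≥ 1`.
[cite: BoyerEtAl1998, §3] -/
theorem thetaOf_pos [NeZero N] {x : Fin N → Bool} (ht : 0 < hw x) : 0 < thetaOf x := by
  unfold thetaOf
  have hN : (0 : ℝ) < N := by exact_mod_cast Nat.pos_of_ne_zero (NeZero.ne N)
  have hq : (0 : ℝ) < hw x / N := div_pos (by exact_mod_cast ht) hN
  exact Real.arcsin_pos.2 (Real.sqrt_pos.2 hq)

/-- "`0 < θ ≤ π/2`": the upper bound. [cite: BoyerEtAl1998, §3] -/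
theorem thetaOf_le_pi_div_two (x : Fin N → Bool) : thetaOf x ≤ π / 2 :=
  Real.arcsin_le_pi_div_two _

/-- "`sin² θ = t/N`". [cite: BoyerEtAl1998, §3] -/
theorem sin_thetaOf_sq [NeZero N] (x : Fin N → Bool) : Real.sin (thetaOf x) ^ 2 = hw x / N := by
  rw [sin_thetaOf, Real.sq_sqrt (by positivity)]

/-- **BBHT 1998 §3 (known `t`)**: with `t = hw x ≥ 1` marked items and `m = ⌊π/(4θ)⌋`,
`θ = thetaOf x`, the `m`-fold Grover iterate has weight `sin²((2m+1)θ) ≥ 1 − t/N` on the marked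
items ("the probability of failure after exactly `m` iterations is … `≤ t/N`").
[cite: BoyerEtAl1998, §3] -/
theorem one_sub_le_sin_sq_bbhtIter_thetaOf [NeZero N] {x : Fin N → Bool} (ht : 0 < hw x) :
    1 - (hw x : ℝ) / N ≤ Real.sin ((2 * (bbhtIter (thetaOf x) : ℝ) + 1) * thetaOf x) ^ 2 := by
  rw [← sin_thetaOf_sq x]
  exact one_sub_sin_sq_le_sin_sq_bbhtIter (thetaOf_pos ht) (thetaOf_le_pi_div_two x)

/-- The same bound for the acceptance probability of the query program of `GroverSearch.lean`:
the branch with `m = ⌊π/(4θ)⌋` active iterations (out of `M ≥ 2` queries, `m ≤ M − 1`) accepts with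
probability `≥ 1 − t/N` (combine `wt_groverBranch` with the bound above).
[cite: BoyerEtAl1998, §3] -/
theorem wt_groverBranch_bbhtIter_ge [NeZero N] {x : Fin N → Bool} (ht : 0 < hw x) {M : ℕ}
    (hM : 2 ≤ M) (hk : bbhtIter (thetaOf x) ≤ M - 1) :
    1 - (hw x : ℝ) / N ≤
      wt {s : Fin N × Bool × Unit | s.2.1 = true}
        (runTok x (groverBranch N M (bbhtIter (thetaOf x))) (Pi.single (startG N) 1)) := by
  rw [wt_groverBranch ht hM hk]
  exact one_sub_le_sin_sq_bbhtIter_thetaOf ht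

/-- **Running time** ("`θ ≥ sin θ = √(t/N)` and therefore `m ≤ π/(4θ) ≤ (π/4)√(N/t)`"):
`m ≤ π / (4 √(t/N))`. [cite: BoyerEtAl1998, §3] -/
theorem bbhtIter_thetaOf_le [NeZero N] {x : Fin N → Bool} (ht : 0 < hw x) :
    (bbhtIter (thetaOf x) : ℝ) ≤ π / (4 * Real.sqrt (hw x / N)) := by
  have hθ := thetaOf_pos ht
  have hs : Real.sqrt (hw x / N) ≤ thetaOf x := by
    rw [← sin_thetaOf]
    exact Real.sin_le hθ.le
  have hspos : 0 < Real.sqrt (hw x / N) := by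
    rw [← sin_thetaOf]
    exact Real.sin_pos_of_pos_of_lt_pi hθ (by linarith [thetaOf_le_pi_div_two x, Real.pi_pos])
  calc (bbhtIter (thetaOf x) : ℝ) ≤ π / (4 * thetaOf x) := bbhtIter_le hθ
    _ ≤ π / (4 * Real.sqrt (hw x / N)) := by
        apply div_le_div_of_nonneg_left Real.pi_pos.le (by positivity)
        exact mul_le_mul_of_nonneg_left hs (by norm_num)

/-- The same in the form `m ≤ (π/4)·√(N/t)`. [cite: BoyerEtAl1998, §3] -/
theorem bbhtIter_thetaOf_le' [NeZero N] {x : Fin N → Bool} (ht : 0 < hw x) :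
    (bbhtIter (thetaOf x) : ℝ) ≤ π / 4 * Real.sqrt (N / hw x) := by
  have hN : (0 : ℝ) < N := by exact_mod_cast Nat.pos_of_ne_zero (NeZero.ne N)
  have htr : (0 : ℝ) < hw x := by exact_mod_cast ht
  have h1 : 0 < Real.sqrt (N : ℝ) := Real.sqrt_pos.2 hN
  have h2 : 0 < Real.sqrt (hw x : ℝ) := Real.sqrt_pos.2 htr
  have e : π / (4 * Real.sqrt (hw x / N)) = π / 4 * Real.sqrt (N / hw x) := by
    rw [Real.sqrt_div' _ hN.le, Real.sqrt_div' _ htr.le]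
    field_simp
  rw [← e]
  exact bbhtIter_thetaOf_le ht

end Marked

end Grover

end Literature.Computability.QuantumComplexity

end
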